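import Literature.Geometry.Lorentzian.Hypersurface
import Literature.Geometry.Riemannian.GaussianShrinker
import Mathlib.Geometry.Manifold.SmoothEmbedding
import Mathlib.MeasureTheory.Measure.Hausdorff
import Mathlib.MeasureTheory.Measure.Lebesgue.EqHaar
import Mathlib.MeasureTheory.Integral.BoundedContinuousFunction
import Mathlib.Topology.ContinuousMap.Bounded.Basic
import HarnessLib

/-!
# Allard's integrality of limits (varifold-free corollary of Allard 1972, Thm. 6.4), for cross-sections of `S⁴ × ℝ ⊂ ℝ⁶`

Topic `Literature/Geometry/GeometricMeasureTheory`.  NAMED FACT (statement only, D-0014), wanted by route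
`Summit.SmoothPoincare4.SmoothPoincare4.Theses.CylinderEntropy`, crux `CylinderRungTwo` (stmt-SmoothPoincare4-7631), line
`killing-flux`: it is the ONLY unproved input of the area-quantization theorem
`Summit.SmoothPoincare4.SmoothPoincare4.Cruxes.CylinderRungTwo.KillingFlux.helper_areaQuantizationOfAllard`
(`Summits/SmoothPoincare4/SmoothPoincare4/Theorems/CylinderEntropyCylinderRungTwoAreaQuantizationOfAllard.lean`), whose
hypothesis is this statement verbatim.

Source: W. K. Allard, *On the first variation of a varifold*, Ann. of Math. 95 (1972) 417–491: Theorem 6.4 (COMPACTNESS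
THEOREM FOR INTEGRAL VARIFOLDS: a set of integral `k`-varifolds in an open `U ⊂ ℝⁿ` whose masses and first variations are
locally uniformly bounded is relatively compact in the weak topology, and every limit is an INTEGRAL varifold) together with
§3.5 / Theorem 5.5 (the density of an integral — indeed of a rectifiable — varifold `v(Γ, θ)` equals the multiplicity `θ`,
a positive integer, `‖V‖`-almost everywhere); also L. Simon, *Lectures on Geometric Measure Theory* (1983), Theorem 42.7,
Remark 42.8 and §38.

## The rendering (no varifolds; WEAKER than the source)

The tree and Mathlib have no varifold / first-variation-of-a-varifold / varifold-convergence vocabulary, so the fact is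
stated for the objects the consumer has: a sequence of smooth embeddings `ι_k : M → ℝ⁶` of ONE closed `4`-manifold `M`
(Hausdorff, second countable, compact, `C^∞` atlas on `ℝ⁴`) with image in the round cylinder
`N = {z | ∑_{i<5} zᵢ² = 1} = S⁴ × ℝ`, each an immersion for the Euclidean metric (`IsSpacelikeImmersion`) with a smooth
unit normal field `ν_k` tangent to `N` (`IsUnitNormal`, `∑ νᵢ zᵢ = 0`), whose areas `μH⁴(range ι_k)` (Mathlib's
un-normalised Hausdorff measure) and total mean curvatures `∫ |H_k| d(ι_k^* μH⁴)` (`H_k` the tree's scalar `meanCurvature`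
of `(ι_k, ν_k)` in `ℝ⁶`, which for `ν_k ⊥ n_N` is the mean curvature of `ι_k(M) ⊂ N`) are bounded by a constant `C`.
These are integral `4`-varifolds `v(ι_k(M))` of `ℝ⁶` (multiplicity one) of mass `≍ C` and first variation
`‖δ v(ι_k(M))‖(ℝ⁶) ≤ ∫ |H⃗^{ℝ⁶}_k| ≤ ∫ (|H_k| + 4)` (the `ℝ⁶`-mean-curvature vector of a `4`-submanifold of `N` is
`H_k ν_k - (tr_{TM} II_N) n_N` with `|tr II_N| ≤ 4`), so Theorem 6.4 applies: a subsequence converges AS VARIFOLDS to an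
integral varifold `V`.  If the weight measures `μH⁴⌊range ι_k` converge weakly (against bounded continuous functions) to a
finite measure `μ`, then `‖V‖ = μ` (weights of converging varifolds converge; weak limits are unique), and by §3.5 the
`4`-density of `μ` exists and is a positive integer `μ`-a.e.  The density is written with Mathlib's `μH[4]` BOTH in the
numerator (the limit of `μH⁴⌊range ι_k`) and in the normaliser `μH⁴(B⁴(0,r))` (a `4`-ball of `ℝ⁴`), so the isodiametric
normalisation constant of Mathlib's Hausdorff measure cancels.  Dropped from the source (hence weaker): the subsequence /
varifold convergence itself, rectifiability and stationarity properties of the limit, general dimension, codimension and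
ambient open set, general integral varifolds as inputs.
-- TODO(general form): integral `m`-varifolds in an open subset of `ℝⁿ` with locally bounded masses and first variations
-- (needs varifold vocabulary: Radon measures on `ℝⁿ × G(n, m)`, first variation, rectifiability à la Allard §§2–5).

## References

* [Allard1972] W. K. Allard, *On the first variation of a varifold*, Ann. of Math. (2) 95 (1972), 417–491, Thm. 6.4, §3.5.
* [Simon1983] L. Simon, *Lectures on Geometric Measure Theory*, Proc. CMA 3, ANU 1983, Thm. 42.7, Rem. 42.8, §38.
-/

noncomputable section

open MeasureTheory Set Filter
open scoped Manifold ContDiff ENNReal NNReal Topology BigOperators BoundedContinuousFunction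

namespace Literature.Geometry.GeometricMeasureTheory

open Literature.Geometry.Riemannian
open Literature.Geometry.Lorentzian Literature.Geometry.Lorentzian.PseudoRiemannianMetric

/-- **Allard 1972, Thm. 6.4 with §3.5 — integrality of weak limits of area measures**, rendered WITHOUT varifolds for smooth
closed embedded cross-sections of the round cylinder `N = S⁴ × ℝ ⊂ ℝ⁶` (NAMED FACT, statement only, D-0014).  Let
`ι_k : M → ℝ⁶` be smooth embeddings of one closed `4`-manifold with image in `N`, Euclidean immersions with smooth unit normals
`ν_k` tangent to `N`, with `μH⁴(range ι_k) ≤ C` and `∫ |H_k| d(ι_k^* μH⁴) ≤ C < ⊤` for all `k` (`H_k` the scalar mean curvature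
of `(ι_k, ν_k)` in `ℝ⁶`).  If the area measures `μH⁴⌊range ι_k` converge weakly — `∫_{range ι_k} g dμH⁴ → ∫ g dμ` for every
bounded continuous `g : ℝ⁶ → ℝ` — to a finite measure `μ`, then for `μ`-a.e. `x` the `4`-density
`lim_{r → 0⁺} μ(B(x,r)) / μH⁴(B_{ℝ⁴}(0,r))` exists and is a POSITIVE INTEGER.  (Allard: the multiplicity-one integral varifolds
`v(ι_k(M))` have masses `≤ c C` and first variations `≤ c (C + 4C)`, so a subsequence converges to an INTEGRAL varifold whose
weight is `μ`; the density of an integral varifold is its multiplicity a.e.)  Weaker than the source; see the module docstring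
for what is dropped and for the normalisation. [cite: Allard1972, Thm. 6.4 and 3.5] -/
def Allard1972_integralDensityOfLimits_cylinderCrossSections : Prop :=
  ∀ (M : Type) [TopologicalSpace M] [T2Space M] [SecondCountableTopology M]
    [ChartedSpace (EuclideanSpace ℝ (Fin 4)) M] [IsManifold (𝓡 4) ∞ M] [CompactSpace M]
    [MeasurableSpace M] [BorelSpace M]
    (ι : ℕ → M → EuclideanSpace ℝ (Fin 6)) (ν : ℕ → M → EuclideanSpace ℝ (Fin 6)),
    (∀ k, Manifold.IsSmoothEmbedding (𝓡 4) (𝓡 6) ∞ (ι k)) →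
    (∀ k x, ∑ i : Fin 5, ι k x (Fin.castSucc i) ^ 2 = 1) →
    ∀ himm : ∀ k, (euclideanMetric (EuclideanSpace ℝ (Fin 6))).IsSpacelikeImmersion (𝓡 4) (ι k),
    (∀ k, (euclideanMetric (EuclideanSpace ℝ (Fin 6))).IsUnitNormal (𝓡 4) (ι k) (ν k) 1) →
    (∀ k x, ∑ i : Fin 5, ν k x (Fin.castSucc i) * ι k x (Fin.castSucc i) = 0) →
    (∀ k, ContMDiff (𝓡 4) (𝓡 6) ∞ (ν k)) →
    ∀ C : ℝ≥0∞, C < ⊤ → (∀ k, μH[4] (Set.range (ι k)) ≤ C) →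
    (∀ k, ∫⁻ x, ENNReal.ofReal
        |(euclideanMetric (EuclideanSpace ℝ (Fin 6))).meanCurvature (ι k) contMDiff_pullbackBilin_holds (himm k)
          (ν k) x| ∂(Measure.comap (ι k) (μH[4] : Measure (EuclideanSpace ℝ (Fin 6)))) ≤ C) →
    ∀ (μ : Measure (EuclideanSpace ℝ (Fin 6))) [IsFiniteMeasure μ],
    (∀ g : BoundedContinuousFunction (EuclideanSpace ℝ (Fin 6)) ℝ,
      Filter.Tendsto (fun k => ∫ z in Set.range (ι k), g z ∂(μH[4] : Measure (EuclideanSpace ℝ (Fin 6))))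
        Filter.atTop (𝓝 (∫ z, g z ∂μ))) →
    ∀ᵐ x ∂μ, ∃ N : ℕ, 0 < N ∧
      Filter.Tendsto (fun r : ℝ => μ (Metric.ball x r) / μH[4] (Metric.ball (0 : EuclideanSpace ℝ (Fin 4)) r))
        (𝓝[>] 0) (𝓝 (N : ℝ≥0∞))

/-! ### Groundwork towards `Allard1972_integralDensityOfLimits_cylinderCrossSections_holds`

PROVED lemmas (no new named facts, D-0026) isolating the elementary, varifold-free parts of the
conclusion: the normaliser `μH[4](B⁴(0,r)) = r⁴ · μH[4](B⁴(0,1))` with `0 < μH[4](B⁴(0,1)) < ⊤`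
(Mathlib: `μH[dim]` is an additive Haar measure), the separation of the normaliser from the density
limit, and three soft properties of the weak limit `μ` of the area measures: it is carried by the
closed cylinder `N = S⁴ × ℝ`, its total mass is `≤ C`, and it vanishes when `M` is empty.  The
varifold part of Allard's theorem (monotonicity, rectifiability and integrality of the limit,
[Allard1972, 5.1, 5.5, 6.4]) is NOT here. -/

namespace Allard1972

/-- `μH[4]` on `ℝ⁴` is an additive Haar measure (Mathlib's `isAddHaarMeasure_hausdorffMeasure` at the
literal dimension `4`). [folklore] -/
theorem isAddHaarMeasure_hausdorffMeasure_fin_four :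
    (μH[4] : Measure (EuclideanSpace ℝ (Fin 4))).IsAddHaarMeasure := by
  have h := isAddHaarMeasure_hausdorffMeasure (E := EuclideanSpace ℝ (Fin 4))
  simp only [finrank_euclideanSpace, Fintype.card_fin, Nat.cast_ofNat] at h
  exact h

/-- **The normaliser scales like `r⁴`:** `μH[4](B⁴(0,r)) = r⁴ · μH[4](B⁴(0,1))` for `r > 0`
(Haar scaling, Mathlib `Measure.addHaar_ball_of_pos`). [folklore] -/
theorem hausdorffMeasure_ball_fin_four {r : ℝ} (hr : 0 < r) :
    μH[4] (Metric.ball (0 : EuclideanSpace ℝ (Fin 4)) r) =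
      ENNReal.ofReal (r ^ 4) * μH[4] (Metric.ball (0 : EuclideanSpace ℝ (Fin 4)) 1) := by
  haveI := isAddHaarMeasure_hausdorffMeasure_fin_four
  have h := Measure.addHaar_ball_of_pos (μH[4] : Measure (EuclideanSpace ℝ (Fin 4))) 0 hr
  simpa [finrank_euclideanSpace] using h

/-- `0 < μH[4](B⁴(0,1))`. [folklore] -/
theorem hausdorffMeasure_unitBall_fin_four_pos :
    0 < μH[4] (Metric.ball (0 : EuclideanSpace ℝ (Fin 4)) 1) :=
  haveI := isAddHaarMeasure_hausdorffMeasure_fin_four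
  Metric.measure_ball_pos _ _ one_pos

/-- `μH[4](B⁴(0,1)) < ⊤`. [folklore] -/
theorem hausdorffMeasure_unitBall_fin_four_lt_top :
    μH[4] (Metric.ball (0 : EuclideanSpace ℝ (Fin 4)) 1) < ⊤ :=
  haveI := isAddHaarMeasure_hausdorffMeasure_fin_four
  measure_ball_lt_top

/-- **Separating the normaliser.** If `μ(B(x,r)) / r⁴ → N · μH[4](B⁴(0,1))` as `r → 0⁺` then the
density in the normalisation of the statement tends to `N`. [folklore] -/
theorem tendsto_ratio_of_tendsto_div_pow {μ : Measure (EuclideanSpace ℝ (Fin 6))}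
    {x : EuclideanSpace ℝ (Fin 6)} {N : ℝ≥0∞}
    (h : Filter.Tendsto (fun r : ℝ => μ (Metric.ball x r) / ENNReal.ofReal (r ^ 4)) (𝓝[>] 0)
      (𝓝 (N * μH[4] (Metric.ball (0 : EuclideanSpace ℝ (Fin 4)) 1)))) :
    Filter.Tendsto
      (fun r : ℝ => μ (Metric.ball x r) / μH[4] (Metric.ball (0 : EuclideanSpace ℝ (Fin 4)) r))
      (𝓝[>] 0) (𝓝 N) := by
  set c := μH[4] (Metric.ball (0 : EuclideanSpace ℝ (Fin 4)) 1) with hc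
  have hc0 : c ≠ 0 := hausdorffMeasure_unitBall_fin_four_pos.ne'
  have hct : c ≠ ⊤ := hausdorffMeasure_unitBall_fin_four_lt_top.ne
  have h' : Filter.Tendsto (fun r : ℝ => μ (Metric.ball x r) / ENNReal.ofReal (r ^ 4) / c)
      (𝓝[>] 0) (𝓝 N) := by
    have := ENNReal.Tendsto.div_const h (Or.inr hc0 : N * c ≠ 0 ∨ c ≠ 0)
    rwa [ENNReal.mul_div_cancel_right hc0 hct] at this
  refine h'.congr' ?_
  filter_upwards [self_mem_nhdsWithin] with r (hr : 0 < r)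
  rw [hausdorffMeasure_ball_fin_four hr, div_eq_mul_inv, div_eq_mul_inv, div_eq_mul_inv,
    ENNReal.mul_inv (Or.inr hct) (Or.inl ENNReal.ofReal_ne_top), mul_assoc]

/-- The coordinates of `ℝ⁶` are continuous. [folklore] -/
theorem continuous_coord (i : Fin 6) : Continuous fun z : EuclideanSpace ℝ (Fin 6) => z i := by
  fun_prop

/-- The round cylinder `N = {z | ∑_{i<5} zᵢ² = 1} = S⁴ × ℝ ⊂ ℝ⁶` is closed. [folklore] -/
theorem isClosed_cylinder :
    IsClosed {z : EuclideanSpace ℝ (Fin 6) | ∑ i : Fin 5, z (Fin.castSucc i) ^ 2 = 1} := by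
  have : Continuous fun z : EuclideanSpace ℝ (Fin 6) => ∑ i : Fin 5, z (Fin.castSucc i) ^ 2 := by
    fun_prop
  exact isClosed_eq this continuous_const

/-- The point `e₀` lies on the cylinder. [folklore] -/
theorem single_mem_cylinder :
    (EuclideanSpace.single (0 : Fin 6) (1 : ℝ)) ∈
      {z : EuclideanSpace ℝ (Fin 6) | ∑ i : Fin 5, z (Fin.castSucc i) ^ 2 = 1} := by
  simp [Fin.sum_univ_five]

/-- **The weak limit is carried by the cylinder.** If every `ι k` maps into the closed cylinder `N`
and the area measures `μH[4]⌊range (ι k)` converge against bounded continuous functions to the finite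
measure `μ`, then `μ(ℝ⁶ ∖ N) = 0` (test the bounded continuous function `min 1 (dist(·, N))`, which
vanishes exactly on `N`).  This is the (soft) localisation of the limit varifold to `N` in
[Allard1972, 6.4]; Portmanteau for closed sets. [folklore] -/
theorem measure_compl_cylinder_eq_zero {M : Type*} (ι : ℕ → M → EuclideanSpace ℝ (Fin 6))
    (hN : ∀ k x, ∑ i : Fin 5, ι k x (Fin.castSucc i) ^ 2 = 1)
    (μ : Measure (EuclideanSpace ℝ (Fin 6))) [IsFiniteMeasure μ]
    (hlim : ∀ g : BoundedContinuousFunction (EuclideanSpace ℝ (Fin 6)) ℝ,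
      Filter.Tendsto
        (fun k => ∫ z in Set.range (ι k), g z ∂(μH[4] : Measure (EuclideanSpace ℝ (Fin 6))))
        Filter.atTop (𝓝 (∫ z, g z ∂μ))) :
    μ {z : EuclideanSpace ℝ (Fin 6) | ∑ i : Fin 5, z (Fin.castSucc i) ^ 2 = 1}ᶜ = 0 := by
  set N := {z : EuclideanSpace ℝ (Fin 6) | ∑ i : Fin 5, z (Fin.castSucc i) ^ 2 = 1} with hN_def
  have hNc : IsClosed N := isClosed_cylinder
  have hNne : N.Nonempty := ⟨_, single_mem_cylinder⟩
  -- the test function `g z = min 1 (infDist z N)`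
  let g₀ : C(EuclideanSpace ℝ (Fin 6), ℝ) :=
    ⟨fun z => min 1 (Metric.infDist z N), (continuous_const.min (Metric.continuous_infDist_pt N))⟩
  have hg₀_nonneg : ∀ z, 0 ≤ g₀ z := fun z => le_min zero_le_one Metric.infDist_nonneg
  have hg₀_le : ∀ z, g₀ z ≤ 1 := fun z => min_le_left _ _
  let g : (EuclideanSpace ℝ (Fin 6)) →ᵇ ℝ := BoundedContinuousFunction.mkOfBound g₀ 2 (by
    intro x y
    rw [Real.dist_eq, abs_le]
    have := hg₀_nonneg x; have := hg₀_nonneg y; have := hg₀_le x; have := hg₀_le y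
    constructor <;> linarith)
  have hg : ∀ z, g z = min 1 (Metric.infDist z N) := fun z => rfl
  have hg_nonneg : ∀ z, 0 ≤ g z := hg₀_nonneg
  have hg_zero : ∀ z ∈ N, g z = 0 := fun z hz => by
    rw [hg, Metric.infDist_zero_of_mem hz, min_eq_right zero_le_one]
  have hgN : ∀ z, z ∉ N → 0 < g z := fun z hz =>
    lt_min one_pos ((hNc.notMem_iff_infDist_pos hNne).1 hz)
  -- each term of the sequence vanishes, hence so does the limit
  have hk : ∀ k,
      ∫ z in Set.range (ι k), g z ∂(μH[4] : Measure (EuclideanSpace ℝ (Fin 6))) = 0 := by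
    intro k
    refine setIntegral_eq_zero_of_forall_eq_zero fun z hz => ?_
    obtain ⟨x, rfl⟩ := hz
    exact hg_zero _ (hN k x)
  have hlim0 : ∫ z, g z ∂μ = 0 := by
    have h := hlim g
    simp_rw [hk] at h
    exact (tendsto_nhds_unique tendsto_const_nhds h).symm
  have hint : Integrable (fun z => g z) μ := BoundedContinuousFunction.integrable μ g
  have hae : (fun z => g z) =ᵐ[μ] 0 :=
    (integral_eq_zero_iff_of_nonneg (fun z => hg_nonneg z) hint).1 hlim0
  have hae' : μ {z | g z ≠ 0} = 0 := by
    have := hae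
    rw [Filter.EventuallyEq, ae_iff] at this
    simpa using this
  refine measure_mono_null (fun z hz => ?_) hae'
  exact (hgN z hz).ne'

/-- **Total mass of the limit:** `μ(ℝ⁶) ≤ C` (test the constant function `1`; the masses
`μH[4](range (ι k)) ≤ C` pass to the limit). [folklore] -/
theorem measure_univ_le_of_tendsto {M : Type*} (ι : ℕ → M → EuclideanSpace ℝ (Fin 6))
    {C : ℝ≥0∞} (hC : C < ⊤) (harea : ∀ k, μH[4] (Set.range (ι k)) ≤ C)
    (μ : Measure (EuclideanSpace ℝ (Fin 6))) [IsFiniteMeasure μ]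
    (hlim : ∀ g : BoundedContinuousFunction (EuclideanSpace ℝ (Fin 6)) ℝ,
      Filter.Tendsto
        (fun k => ∫ z in Set.range (ι k), g z ∂(μH[4] : Measure (EuclideanSpace ℝ (Fin 6))))
        Filter.atTop (𝓝 (∫ z, g z ∂μ))) :
    μ Set.univ ≤ C := by
  have h := hlim (BoundedContinuousFunction.const _ (1 : ℝ))
  simp only [BoundedContinuousFunction.const_apply, integral_const, smul_eq_mul, mul_one,
    Measure.restrict_apply MeasurableSet.univ, Set.univ_inter, measureReal_def] at h
  have hle : ∀ k, (μH[4] (Set.range (ι k))).toReal ≤ C.toReal := fun k =>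
    ENNReal.toReal_mono hC.ne (harea k)
  have hlim_le : (μ Set.univ).toReal ≤ C.toReal := le_of_tendsto' h hle
  exact (ENNReal.toReal_le_toReal (measure_ne_top μ _) hC.ne).1 hlim_le

/-- **Empty `M`:** if `M` is empty the limit measure vanishes (so the conclusion of the statement is
vacuous in that case). [folklore] -/
theorem measure_eq_zero_of_isEmpty {M : Type*} [IsEmpty M] (ι : ℕ → M → EuclideanSpace ℝ (Fin 6))
    (μ : Measure (EuclideanSpace ℝ (Fin 6))) [IsFiniteMeasure μ]
    (hlim : ∀ g : BoundedContinuousFunction (EuclideanSpace ℝ (Fin 6)) ℝ,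
      Filter.Tendsto
        (fun k => ∫ z in Set.range (ι k), g z ∂(μH[4] : Measure (EuclideanSpace ℝ (Fin 6))))
        Filter.atTop (𝓝 (∫ z, g z ∂μ))) :
    μ = 0 := by
  have h0 : ∀ k, μH[4] (Set.range (ι k)) ≤ (0 : ℝ≥0∞) := fun k => by
    rw [Set.range_eq_empty, measure_empty]
  have := measure_univ_le_of_tendsto ι ENNReal.zero_lt_top h0 μ hlim
  exact Measure.measure_univ_eq_zero.1 (le_antisymm this bot_le)

end Allard1972

end Literature.Geometry.GeometricMeasureTheory

end
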